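import Summits.CriticalPhenomena.CardyFormulaZ2.Theses.CardySelfDualSegment
import Summits.CriticalPhenomena.CardyFormulaZ2.Theorems.CardyMagicRigidityLoopsToCrossingsStubComparisonGeometry
import Summits.CriticalPhenomena.CardyFormulaZ2.Theorems.CardyMagicRigidityLoopsToCrossingsStubCardyContinuity
import Literature.Probability.Percolation.CornerPercolation
import Literature.Probability.Percolation.CardyFormulaConformalInvariance
import Literature.Probability.Percolation.TriCrossingSandwich
import Literature.Probability.LatticeModels.TriangularLatticeProofs
import Literature.Probability.RandomPlanarGeometry.ImageUnivalent
import Literature.Probability.RandomPlanarGeometry.CollarGeometry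
import Literature.Barriers.CriticalPhenomena.EmbeddingModulusUniquenessProofs

/-!
# Crux `SmirnovBasePoint` (stmt-CriticalPhenomena-5474), line `Sketch`: stub `stub_lowerInclusion`

The lower exact inclusion of the sheared two-quad oracle sandwich, in the triangular frame.
Let `R = (Ω; arcs 0–3)` be a conformal rectangle and `Q` a comparison quad in lower sandwich
position with room `r`, lateral margin `m` and plate margin `t` (the clauses exported by
`OracleSandwich.exists_lowerQuad R`): points of the `r`-fattening `Q_r` of `Q` off `Ω` are within
`t` of `arc 0` or of `arc 2`, points of `Q_r` in `Ω` are `m`-far from `arc 1` and `arc 3`, and the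
`r`-fattenings of `Q.arc 0`, `Q.arc 2` lie off `Ω` within `t` of `arc 0`, `arc 2`; moreover
`3t < dist (arc 0, arc 2)`. Then for `0 < δ < min r (min m (t/2))` every G02 crossing
`triCrossing Q.carrier δ (Q.arc 0) (Q.arc 2)` of the site configuration `ω` is a crude `𝕋`-frame
crossing of `R` with slack `δ` of the bond configuration `upTriangleConfig ω`: an open bond path
with all vertices `δ`-inside `Ω` from a vertex within `δ` of `arc 0` to a vertex within `δ` of
`arc 2`.

Proof (Bollobás–Riordan 2006, Ch. 7, Claim 19 p. 192 and the remark p. 195, for the crude event):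
the G02 event gives a `𝕋`-path of open sites of `Q_δ` from the discrete arc of `Q.arc 0` to that
of `Q.arc 2`; the bond realisation hypothesis (stub B1) turns it into an open bond path of
`upTriangleConfig ω` whose vertices are such sites or apexes of such sites, all in `Q_r`. Its
vertices are classified as inside `Ω`, outside near `arc 0`, outside near `arc 2`; bond-adjacent
vertices are `𝕋`-adjacent at mesh distance `δ`, so (as `2t + 2δ < 3t`) no step is both near
`arc 0` and near `arc 2`. Run extraction (`PathIn.exists_run`) yields, between the last step near
`arc 0` and the first later step near `arc 2`, a run of inside steps; the entering edge exits `Ω`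
through `arc 0` within `δ` of the first inside vertex (`NearOut.exists_exit`: the exit point is a
frontier point within `δ < m` of a point of `Q_r ∩ Ω`, hence off `arc 1 ∪ arc 3`, and within
`t + δ` of `arc 0`, hence off `arc 2`), and symmetrically at the far end.
-/

noncomputable section

namespace Summit.CriticalPhenomena.CardyFormulaZ2.Cruxes.SmirnovBasePoint.ShearedSandwich

open Literature.Probability.RandomPlanarGeometry hiding cardyFunction
open Literature.Probability.Percolation hiding cardyFunction
open Literature.Probability.LatticeModels
open Literature.Barriers.CriticalPhenomena
open Summit.CriticalPhenomena.CardyFormulaZ2.Cruxes.LoopsToCrossings.OracleSandwich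
open Filter Topology Set MeasureTheory Metric

namespace LowerInclusion

/-- Adjacency in the subgraph of `G` spanned by the steps with both ends in `P`, unfolded.
[folklore] -/
theorem fromRel_adj_iff {V : Type*} {G : SimpleGraph V} {P : Set V} {p q : V} :
    (SimpleGraph.fromRel fun a b => G.Adj a b ∧ a ∈ P ∧ b ∈ P).Adj p q ↔
      G.Adj p q ∧ p ∈ P ∧ q ∈ P := by
  simp only [SimpleGraph.fromRel_adj, ne_eq]
  constructor
  · rintro ⟨-, h | h⟩
    · exact h
    · exact ⟨h.1.symm, h.2.2, h.2.1⟩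
  · intro h
    exact ⟨h.1.ne, Or.inl h⟩

/-- A path of the subgraph of `G` spanned by the steps with both ends in `P`, starting in `P`, is
a `G`-path inside `P`. [folklore] -/
theorem pathIn_of_pathIn_fromRel {V : Type*} {G : SimpleGraph V} {P S : Set V} {a b : V}
    (h : PathIn (SimpleGraph.fromRel fun p q => G.Adj p q ∧ p ∈ P ∧ q ∈ P) S a b)
    (ha : a ∈ P) :
    PathIn G P a b := by
  obtain ⟨-, hr⟩ := h
  induction hr with
  | refl => exact PathIn.refl ha
  | @tail p q _ hpq ih =>
    obtain ⟨hadj, -, hq⟩ := fromRel_adj_iff.1 hpq.1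
    exact ih.tail hadj hq

/-- Vertices adjacent in the bond picture `upTriangleConfig ω` (a set of edges of `ℤ²`) are
`𝕋`-adjacent. [folklore] -/
theorem triGraph_adj_of_openGraph_adj {ω : SiteConfig (Site 2)} {p q : Site 2}
    (h : (openGraph (upTriangleConfig ω)).Adj p q) : triGraph.Adj p q := by
  rw [openGraph_adj] at h
  exact zdGraph_le_triGraph ((SimpleGraph.mem_edgeSet (zdGraph 2)).1
    (upTriangleConfig_subset_edgeSet ω h.1))

/-- A site and its apexes `x + e₀`, `x + e₁` are `𝕋`-adjacent. [folklore] -/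
theorem triGraph_adj_apex {x w : Site 2} (hw : w = x + ![1, 0] ∨ w = x + ![0, 1]) :
    triGraph.Adj x w := by
  refine zdGraph_le_triGraph ((zdGraph_adj_iff x w).2 ?_)
  rcases hw with rfl | rfl
  · exact ⟨0, Or.inl (by rw [vec10_eq_single])⟩
  · exact ⟨1, Or.inl (by rw [vec01_eq_single])⟩

end LowerInclusion

/-- **Stub B (lower exact inclusion).** Given the bond realisation (stub B1), for a comparison
quad `Q` in lower sandwich position w.r.t. `R` (the clauses of `OracleSandwich.exists_lowerQuad R`)
every G02 crossing of `Q` at small mesh `δ` is a `𝕋`-frame crude crossing of `R` with slack `δ`: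
run extraction between the last bond vertex off `Ω` near `arc 0` and the first later one near
`arc 2`; the entering bond exits `Ω` through `arc 0` within `δ` of the first inside vertex.
[cite: BollobasRiordan2006, Ch. 7 Claim 19 p. 192 and remark p. 195] -/
theorem stub_lowerInclusion :
    (∀ (ω : SiteConfig (Site 2)) (T : Set (Site 2)) (a b : Site 2),
      PathIn triGraph (T ∩ ω) a b →
        PathIn (openGraph (upTriangleConfig ω))
          {w : Site 2 | w ∈ T ∩ ω ∨ ∃ x ∈ T ∩ ω, w = x + ![1, 0] ∨ w = x + ![0, 1]} a b) →
    ∀ (R Q : ConformalRectangle) (r m t : ℝ), 0 < r → 0 < m → 0 < t →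
      (∀ p ∈ R.arc 0, ∀ q ∈ R.arc 2, 3 * t < dist p q) →
      (∀ z ∈ cthickening r Q.carrier, z ∉ R.carrier → infDist z (R.arc 0) ≤ t ∨ infDist z (R.arc 2) ≤ t) →
      (∀ z ∈ cthickening r Q.carrier, z ∈ R.carrier → m ≤ infDist z (R.arc 1) ∧ m ≤ infDist z (R.arc 3)) →
      (∀ z ∈ cthickening r (Q.arc 0), z ∉ R.carrier ∧ infDist z (R.arc 0) ≤ t) →
      (∀ z ∈ cthickening r (Q.arc 2), z ∉ R.carrier ∧ infDist z (R.arc 2) ≤ t) →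
      ∃ δ₀ > 0, ∀ δ : ℝ, 0 < δ → δ < δ₀ →
        triCrossing Q.carrier δ (Q.arc 0) (Q.arc 2) ⊆ upTriangleConfig ⁻¹' openCrossing
          {y : Site 2 | triMeshPoint δ y ∈ R.carrier}
          {u : Site 2 | infDist (triMeshPoint δ u) (R.arc 0) ≤ δ}
          {v : Site 2 | infDist (triMeshPoint δ v) (R.arc 2) ≤ δ} := by
  intro hB1 R Q r m t hr hm ht hsep c1 c2 c3 c4
  refine ⟨min r (min m (t / 2)), by positivity, fun δ hδ hδlt => ?_⟩
  have hδr : δ ≤ r := (hδlt.trans_le (min_le_left _ _)).le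
  have hδm : δ < m := hδlt.trans_le ((min_le_right _ _).trans (min_le_left _ _))
  have hδt : δ < t / 2 := hδlt.trans_le ((min_le_right _ _).trans (min_le_right _ _))
  have hδabs : |δ| = δ := abs_of_pos hδ
  set Ω := R.carrier
  set A := R.arc 0
  set B := R.arc 2
  have hΩo : IsOpen Ω := R.isOpen
  have hfr : frontier Ω ⊆ (A ∪ B) ∪ (R.arc 1 ∪ R.arc 3) := frontier_subset_arcs_zero_two R
  have hfr' : frontier Ω ⊆ (B ∪ A) ∪ (R.arc 1 ∪ R.arc 3) :=
    hfr.trans (by rw [union_comm A B])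
  have hAne : A.Nonempty := ⟨_, R.pt_mem_arc_self 0⟩
  have hBne : B.Nonempty := ⟨_, R.pt_mem_arc_self 2⟩
  have hAB : ∀ p ∈ A, ∀ q ∈ B, 2 * t + 2 * δ < dist p q := fun p hp q hq => by
    linarith [hsep p hp q hq]
  have hBA : ∀ p ∈ B, ∀ q ∈ A, 2 * t + 2 * δ < dist p q := fun p hp q hq => by
    rw [dist_comm]; exact hAB q hq p hp
  rintro ω ⟨x, hx, y, hy, hconn⟩
  -- the site path of the G02 event and its bond realisation
  set T := triMeshDomain Q.carrier δ
  have hP : PathIn triGraph (T ∩ ω) x y :=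
    (mem_siteConnIn_iff_pathIn.1 hconn).mono_graph
      ((triDiscreteDomainGraph_le_triMeshGraph Q.carrier δ).trans
        (triMeshGraph_le_triGraph Q.carrier δ))
  set W : Set (Site 2) :=
    {w : Site 2 | w ∈ T ∩ ω ∨ ∃ x ∈ T ∩ ω, w = x + ![1, 0] ∨ w = x + ![0, 1]}
  set G := openGraph (upTriangleConfig ω)
  have hPW : PathIn G W x y := hB1 ω T x y hP
  have hGtri : ∀ {p q : Site 2}, G.Adj p q → triGraph.Adj p q := fun h =>
    LowerInclusion.triGraph_adj_of_openGraph_adj h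
  -- every vertex of `W` lies in the `r`-fattening of `Q`
  have hWr : ∀ w ∈ W, triMeshPoint δ w ∈ cthickening r Q.carrier := by
    rintro w (hw | ⟨x', hx', hw⟩)
    · exact self_subset_cthickening _ (triMeshDomain_subset_triMeshVertices _ _ hw.1)
    · refine mem_cthickening_of_dist_le _ _ _ _
        (triMeshDomain_subset_triMeshVertices _ _ hx'.1) ?_
      rw [dist_comm, dist_triMeshPoint_of_triGraph_adj (LowerInclusion.triGraph_adj_apex hw), hδabs]
      exact hδr
  -- the classification of the vertices of `W`
  have hout : ∀ w ∈ W, triMeshPoint δ w ∉ Ω →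
      infDist (triMeshPoint δ w) A ≤ t ∨ infDist (triMeshPoint δ w) B ≤ t :=
    fun w hw hwΩ => c1 _ (hWr w hw) hwΩ
  have hin : ∀ w ∈ W, triMeshPoint δ w ∈ Ω →
      δ < infDist (triMeshPoint δ w) (R.arc 1) ∧ δ < infDist (triMeshPoint δ w) (R.arc 3) :=
    fun w hw hwΩ =>
      ⟨hδm.trans_le (c2 _ (hWr w hw) hwΩ).1, hδm.trans_le (c2 _ (hWr w hw) hwΩ).2⟩
  -- the endpoints are off `Ω`, near `arc 0` and near `arc 2`
  have hcth : ∀ (i : Fin 4) {z : Site 2}, z ∈ triDiscreteArc Q.carrier δ (Q.arc i) →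
      triMeshPoint δ z ∈ cthickening r (Q.arc i) := fun i z hz => by
    obtain ⟨p, hp, hpd⟩ :=
      (Q.isCompact_arc i).exists_infDist_eq_dist ⟨_, Q.pt_mem_arc_self i⟩ (triMeshPoint δ z)
    refine mem_cthickening_of_dist_le _ _ _ _ hp ?_
    have := infDist_le_of_mem_triDiscreteArc Q.isOpen hz
    rw [hδabs, hpd] at this
    exact this.trans hδr
  obtain ⟨hxΩ, hxA⟩ : triMeshPoint δ x ∉ Ω ∧ infDist (triMeshPoint δ x) A ≤ t := c3 _ (hcth 0 hx)
  obtain ⟨hyΩ, hyB⟩ : triMeshPoint δ y ∉ Ω ∧ infDist (triMeshPoint δ y) B ≤ t := c4 _ (hcth 2 hy)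
  -- the three kinds of steps
  set S : Set (Site 2) := {w : Site 2 | triMeshPoint δ w ∈ Ω}
  set H : SimpleGraph (Site 2) := SimpleGraph.fromRel fun p q => G.Adj p q ∧ p ∈ S ∧ q ∈ S
  have hHadj : ∀ {p q : Site 2}, H.Adj p q ↔ G.Adj p q ∧ p ∈ S ∧ q ∈ S :=
    LowerInclusion.fromRel_adj_iff
  have hHG : H ≤ G := fun p q h => (hHadj.1 h).1
  have hclass : ∀ a ∈ W, ∀ b ∈ W, G.Adj a b →
      H.Adj a b ∨ NearOut Ω δ A t a b ∨ NearOut Ω δ B t a b := by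
    intro a haW b hbW hab
    by_cases haΩ : triMeshPoint δ a ∈ Ω
    · by_cases hbΩ : triMeshPoint δ b ∈ Ω
      · exact Or.inl (hHadj.2 ⟨hab, haΩ, hbΩ⟩)
      · rcases hout b hbW hbΩ with h | h
        · exact Or.inr (Or.inl (NearOut.of_left hbΩ h).symm)
        · exact Or.inr (Or.inr (NearOut.of_left hbΩ h).symm)
    · rcases hout a haW haΩ with h | h
      · exact Or.inr (Or.inl (NearOut.of_left haΩ h))
      · exact Or.inr (Or.inr (NearOut.of_left haΩ h))
  have hu' : ∀ b ∈ W, G.Adj x b → ¬ H.Adj x b ∧ NearOut Ω δ A t x b := fun b _ _ =>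
    ⟨fun h => hxΩ (hHadj.1 h).2.1, NearOut.of_left hxΩ hxA⟩
  have hv' : ∀ a ∈ W, G.Adj a y → ¬ H.Adj a y ∧ ¬ NearOut Ω δ A t a y := fun a _ hay =>
    ⟨fun h => hyΩ (hHadj.1 h).2.2,
      fun h => h.not_nearOut hδ hAne hBne hAB (hGtri hay) (NearOut.of_left hyΩ hyB).symm⟩
  have hxy : x ≠ y := by
    rintro rfl
    obtain ⟨p, hp, hxp⟩ := (infDist_lt_iff hAne).1
      (show infDist (triMeshPoint δ x) A < t + δ by linarith)
    obtain ⟨q, hq, hxq⟩ := (infDist_lt_iff hBne).1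
      (show infDist (triMeshPoint δ x) B < t + δ by linarith)
    linarith [hAB p hp q hq, dist_triangle p (triMeshPoint δ x) q, dist_comm p (triMeshPoint δ x)]
  obtain ⟨a', a, b, b', -, ha'a, -, hL0, hrun, -, hbb', -, hnL0, hL2⟩ :=
    PathIn.exists_run (H := H) hHG hclass hu' hv' hxy hPW
  have haW : a ∈ W := hrun.left_mem
  have hbW : b ∈ W := hrun.right_mem
  -- the ends of the run are inside `Ω`
  have haΩ : triMeshPoint δ a ∈ Ω := by
    by_contra h
    rcases hout a haW h with h' | h'
    · by_cases hab : a = b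
      · subst hab
        exact hnL0 (NearOut.of_left h h')
      · obtain ⟨c, -, hac⟩ := hrun.exists_adj_head hab
        exact h (hHadj.1 hac).2.1
    · exact hL0.not_nearOut hδ hAne hBne hAB (hGtri ha'a) (NearOut.of_left h h').symm
  have hbΩ : triMeshPoint δ b ∈ Ω := by
    by_contra h
    rcases hout b hbW h with h' | h'
    · exact hnL0 (NearOut.of_left h h')
    · by_cases hab : a = b
      · subst hab
        exact h haΩ
      · obtain ⟨c, -, hcb⟩ := hrun.exists_adj_last hab
        exact h (hHadj.1 hcb).2.2
  -- the exits at the two ends: through `arc 0` near `a`, through `arc 2` near `b`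
  obtain ⟨sa, fa, -, -, -, -, -, hfaA, hafa, -⟩ :=
    hL0.exists_exit hΩo hfr hAne hδ hAB (hGtri ha'a) haΩ (hin a haW haΩ)
  obtain ⟨sb, fb, -, -, -, -, -, hfbB, hbfb, -⟩ :=
    hL2.symm.exists_exit hΩo hfr' hBne hδ hBA (hGtri hbb').symm hbΩ (hin b hbW hbΩ)
  -- the run is an open bond path inside `Ω`
  have hpath : PathIn G S a b := LowerInclusion.pathIn_of_pathIn_fromRel hrun haΩ
  show upTriangleConfig ω ∈ openCrossing S _ _
  rw [mem_openCrossing_iff]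
  exact ⟨a, (infDist_le_dist_of_mem hfaA).trans hafa, b, (infDist_le_dist_of_mem hfbB).trans hbfb,
    DCT16.mem_openConnIn_iff_pathIn.2 hpath⟩

end Summit.CriticalPhenomena.CardyFormulaZ2.Cruxes.SmirnovBasePoint.ShearedSandwich
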